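import Summits.RiemannHypothesis.RiemannHypothesis.Theses.RuelleBand
import Literature.NumberTheory.LFunctions.WeilCriterionConverse
import HarnessLib.Audit

/-!
# Line `SketchIdeator1` (even Weil sector), stub 1: symmetric translates

Crux `RuelleBand.ExactFirstBand` (stmt-RiemannHypothesis-2061), line `SketchIdeator1` (Weil positivity on the
EVEN REAL sector of test functions ⟹ every zero of `ζ` in the open strip is on the critical line or the real
axis).  This file proves the registered stub `stub_evenSymTranslate`: for a test function `g` and a real `x`
the symmetric translate `h_x(t) = (g(t - x) + g(t + x)) / 2`

* is again a test function (`h_x = ½ (g_x + g_{-x})` with `g_x = weilTranslate g x`);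
* is even whenever `g` is even, and real-valued whenever `g` is;
* has transform `ĥ_x(s) = ĝ(s) · (e^{(s - 1/2) x} + e^{-(s - 1/2) x}) / 2` (`weilMellin_weilTranslate`);
* has zero-side Weil form `Q(h_x) = (Re B_g(2x) + Q(g)) / 2`, where `Q = WeilConverse.zeroForm` and
  `B_g = WeilConverse.expSum` is the generalised Dirichlet series `∑_ρ m(ρ) P_g(ρ) e^{(ρ - 1/2) x}` over the
  non-trivial zeros: termwise `P_{h_x}(ρ) = P_g(ρ) · ((E + E⁻¹)/2)²` with `E = e^{(ρ - 1/2) x}` (the conjugate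
  factor at `1 - ρ̄` reproduces `(E⁻¹ + E)/2` because `x` is real), `((E + E⁻¹)/2)² = (E² + 2 + E⁻²)/4`, and
  summing gives `(B_g(2x) + A_g(2x) + 2 Q(g)) / 4` with `A_g = expSum' g = conj ∘ B_g`
  (`WeilConverse.conj_expSum'`), i.e. `(Re B_g(2x) + Q(g)) / 2`.

This is the symmetric analogue of the tree's polarisation identity `WeilConverse.zeroForm_translateMix`.
-/

set_option linter.dupNamespace false

noncomputable section

open Complex MeasureTheory Filter Set
open scoped Real Topology ComplexConjugate

namespace Summit.RiemannHypothesis.RiemannHypothesis.Theorems.RuelleBandExactFirstBand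

open Literature.NumberTheory.LFunctions

/-- The symmetric translate is half the sum of the two translates `g_x`, `g_{-x}`
(`weilTranslate g x t = g (t - x)`, and `t + x = t - (-x)`). -/
theorem symTranslate_eq_weilTranslate (g : ℝ → ℂ) (x : ℝ) :
    (fun t : ℝ => (g (t - x) + g (t + x)) / 2) =
      fun t : ℝ => (1 / 2 : ℂ) * (weilTranslate g x + weilTranslate g (-x)) t := by
  funext t
  simp only [Pi.add_apply, weilTranslate, sub_neg_eq_add]
  ring

/-- The symmetric translate of a test function is a test function. -/
theorem isWeilTest_symTranslate {g : ℝ → ℂ} (hg : IsWeilTest g) (x : ℝ) :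
    IsWeilTest (fun t : ℝ => (g (t - x) + g (t + x)) / 2) := by
  rw [symTranslate_eq_weilTranslate]
  exact ((hg.weilTranslate x).add (hg.weilTranslate (-x))).const_mul (1 / 2)

/-- The symmetric translate of an even function is even. -/
theorem symTranslate_even {g : ℝ → ℂ} (he : ∀ t : ℝ, g (-t) = g t) (x t : ℝ) :
    (g (-t - x) + g (-t + x)) / 2 = (g (t - x) + g (t + x)) / 2 := by
  rw [show -t - x = -(t + x) by ring, show -t + x = -(t - x) by ring, he, he, add_comm]

/-- The symmetric translate of a real-valued function is real-valued. -/
theorem symTranslate_im {g : ℝ → ℂ} (hr : ∀ t : ℝ, (g t).im = 0) (x t : ℝ) :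
    ((g (t - x) + g (t + x)) / 2).im = 0 := by
  rw [Complex.div_ofNat_im, Complex.add_im, hr, hr, add_zero, zero_div]

/-- Transform of the symmetric translate: `ĥ_x(s) = ĝ(s) · (e^{(s-1/2)x} + e^{-(s-1/2)x}) / 2`
(linearity and `weilMellin_weilTranslate`). -/
theorem weilMellin_symTranslate {g : ℝ → ℂ} (hg : IsWeilTest g) (x : ℝ) (s : ℂ) :
    weilMellin (fun t : ℝ => (g (t - x) + g (t + x)) / 2) s =
      weilMellin g s * ((cexp ((s - 1 / 2) * x) + cexp (-((s - 1 / 2) * x))) / 2) := by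
  have h1 : IsWeilTest (weilTranslate g x) := hg.weilTranslate x
  have h2 : IsWeilTest (weilTranslate g (-x)) := hg.weilTranslate (-x)
  rw [symTranslate_eq_weilTranslate, weilMellin_const_mul,
    weilMellin_add h1.1.continuous h1.2 h2.1.continuous h2.2, weilMellin_weilTranslate,
    weilMellin_weilTranslate,
    show (s - 1 / 2) * (((-x : ℝ) : ℂ)) = -((s - 1 / 2) * (x : ℂ)) by push_cast; ring]
  ring

/-- Termwise zero-side coefficient of the symmetric translate:
`P_{h_x}(ρ) = P_g(ρ) · (e^{(ρ-1/2)·2x} + e^{(1/2-ρ)·2x} + 2) / 4` (the conjugate of the transform factor at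
`1 - ρ̄` is the same factor because `x` is real, and `e^{(ρ-1/2)x} e^{-(ρ-1/2)x} = 1`). -/
theorem pairCoeff_symTranslate {g : ℝ → ℂ} (hg : IsWeilTest g) (x : ℝ) (ρ : ℂ) :
    WeilConverse.pairCoeff (fun t : ℝ => (g (t - x) + g (t + x)) / 2) ρ =
      WeilConverse.pairCoeff g ρ *
        ((cexp ((ρ - 1 / 2) * ((2 * x : ℝ) : ℂ)) + cexp ((1 / 2 - ρ) * ((2 * x : ℝ) : ℂ)) + 2) / 4) := by
  have hE2 : cexp ((ρ - 1 / 2) * x) * cexp ((ρ - 1 / 2) * x) = cexp ((ρ - 1 / 2) * ((2 * x : ℝ) : ℂ)) := by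
    rw [← Complex.exp_add]
    congr 1
    push_cast
    ring
  have hE'2 : cexp (-((ρ - 1 / 2) * x)) * cexp (-((ρ - 1 / 2) * x)) =
      cexp ((1 / 2 - ρ) * ((2 * x : ℝ) : ℂ)) := by
    rw [← Complex.exp_add]
    congr 1
    push_cast
    ring
  have hEE' : cexp ((ρ - 1 / 2) * x) * cexp (-((ρ - 1 / 2) * x)) = 1 := by
    rw [← Complex.exp_add, ← Complex.exp_zero]
    congr 1
    ring
  have hF : conj (cexp ((1 - conj ρ - 1 / 2) * x)) = cexp (-((ρ - 1 / 2) * x)) := by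
    rw [← Complex.exp_conj]
    congr 1
    simp only [map_mul, map_sub, map_one, map_div₀, map_ofNat, Complex.conj_conj,
      Complex.conj_ofReal]
    ring
  have hF' : conj (cexp (-((1 - conj ρ - 1 / 2) * x))) = cexp ((ρ - 1 / 2) * x) := by
    rw [← Complex.exp_conj]
    congr 1
    simp only [map_neg, map_mul, map_sub, map_one, map_div₀, map_ofNat, Complex.conj_conj,
      Complex.conj_ofReal]
    ring
  rw [WeilConverse.pairCoeff, WeilConverse.pairCoeff, weilMellin_symTranslate hg,
    weilMellin_symTranslate hg, map_mul, map_div₀, map_add, hF, hF', map_ofNat]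
  linear_combination
    weilMellin g ρ * conj (weilMellin g (1 - conj ρ)) / 4 * (hE2 + hE'2 + 2 * hEE')

/-- `A_g = conj ∘ B_g` (from `conj A_g = B_g`, `WeilConverse.conj_expSum'`). -/
theorem expSum'_eq_conj_expSum (g : ℝ → ℂ) (y : ℝ) :
    WeilConverse.expSum' g y = conj (WeilConverse.expSum g y) := by
  rw [← WeilConverse.conj_expSum' g y, Complex.conj_conj]

/-- Zero-side Weil form of the symmetric translate: `Q(h_x) = (Re B_g(2x) + Q(g)) / 2` (sum the termwise
identity `pairCoeff_symTranslate` against the absolutely convergent series `B_g(2x)`, `A_g(2x)`, `Q(g)`, and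
use `B_g + A_g = B_g + conj B_g = 2 Re B_g`). -/
theorem zeroForm_symTranslate {g : ℝ → ℂ} (hg : IsWeilTest g) (x : ℝ) :
    WeilConverse.zeroForm (fun t : ℝ => (g (t - x) + g (t + x)) / 2) =
      ((((WeilConverse.expSum g (2 * x)).re : ℝ) : ℂ) + WeilConverse.zeroForm g) / 2 := by
  have hP := (WeilConverse.summable_pairCoeff hg).hasSum
  have hA := (WeilConverse.summable_expSum' hg (2 * x)).hasSum
  have hB := (WeilConverse.summable_expSum hg (2 * x)).hasSum
  have h := ((hB.add hA).add (hP.mul_left 2)).div_const 4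
  have hre : (((WeilConverse.expSum g (2 * x)).re : ℝ) : ℂ) =
      (WeilConverse.expSum g (2 * x) + WeilConverse.expSum' g (2 * x)) / 2 := by
    rw [expSum'_eq_conj_expSum, Complex.add_conj]
    push_cast
    ring
  rw [hre, WeilConverse.zeroForm]
  refine Eq.trans (tsum_congr fun ρ ↦ ?_) (h.tsum_eq.trans ?_)
  · rw [pairCoeff_symTranslate hg]
    ring
  · show (WeilConverse.expSum g (2 * x) + WeilConverse.expSum' g (2 * x) +
        2 * WeilConverse.zeroForm g) / 4 = _
    ring

/-- **Stub 1 of line `SketchIdeator1` — symmetric translates.** For a test function `g` and real `x`, the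
symmetric translate `h_x(t) = (g(t-x) + g(t+x))/2` is a test function, is even if `g` is even, is real-valued
if `g` is, has transform `ĥ_x(s) = ĝ(s) (e^{(s-1/2)x} + e^{-(s-1/2)x})/2`, and its zero-side form is
`Q(h_x) = (Re B_g(2x) + Q(g))/2` where `B_g = WeilConverse.expSum g`, `Q = WeilConverse.zeroForm`. -/
theorem stub_evenSymTranslate :
    ∀ (g : ℝ → ℂ), IsWeilTest g → ∀ x : ℝ,
      IsWeilTest (fun t : ℝ => (g (t - x) + g (t + x)) / 2) ∧
      ((∀ t : ℝ, g (-t) = g t) → ∀ t : ℝ, (g (-t - x) + g (-t + x)) / 2 = (g (t - x) + g (t + x)) / 2) ∧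
      ((∀ t : ℝ, (g t).im = 0) → ∀ t : ℝ, ((g (t - x) + g (t + x)) / 2).im = 0) ∧
      (∀ s : ℂ, weilMellin (fun t : ℝ => (g (t - x) + g (t + x)) / 2) s =
        weilMellin g s * ((cexp ((s - 1 / 2) * x) + cexp (-((s - 1 / 2) * x))) / 2)) ∧
      WeilConverse.zeroForm (fun t : ℝ => (g (t - x) + g (t + x)) / 2) =
        ((((WeilConverse.expSum g (2 * x)).re : ℝ) : ℂ) + WeilConverse.zeroForm g) / 2 :=
  fun _ hg x =>
    ⟨isWeilTest_symTranslate hg x, fun he t => symTranslate_even he x t, fun hr t => symTranslate_im hr x t,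
      fun s => weilMellin_symTranslate hg x s, zeroForm_symTranslate hg x⟩

end Summit.RiemannHypothesis.RiemannHypothesis.Theorems.RuelleBandExactFirstBand

end
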